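import Mathlib
import Summits.ResolutionOfSingularities.ResolutionOfSingularities.Theorems.WildQuotientsWildQuotientResolutionS1W1NChartSetup

/-!
# S1 / W1N cascade — Part V: the first step at a type-N node, chart 1 at 0 — coefficient bookkeeping and the set-up at `a₀₁ ≠ 0`

Crux stmt-ResolutionOfSingularities-17941 (`WildQuotients.CyclicQuotientFourfolds`), S1a line `s1a-logminvertex`,
stub `stub_W1N_print`, sub-line `w1n-cascade` (idea-1 `W1N-LINE.md`; proofs from `CombinedW1NPrint.scratch.lean`
f33256b0cfc42851).  [OURS · L1 W4.5c] — NOT a statement of the manuscript; counted 0 post-V5.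

`exists_typeN_setup`: at a node with `a₀₁ ≠ 0` the chart-1-at-0 set-up has `ma = 1`, `mg = 2`, `s = β = 0`, `α = 1`,
`θ' = (x·A, G)` with the jets `A(0,0) = a₁₀`, `G(0,0) = b₁₀`, `G_y(0,0) = b₀₁ − a₁₀`, `G_x(0,0) = b₂₀` and the colength
bookkeeping `μ(θ') = eG + I(A,G)`, `fA ≤ 1`, `eG ≤ 2`, `I(A,B*) + mb ≤ μ`.
-/

-- single-problem summit: the doubled namespace component `ResolutionOfSingularities` is forced
set_option linter.dupNamespace false

noncomputable section

open MvPowerSeries IsLocalRing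
open Literature.AlgebraicGeometry.Resolution
open Summit.ResolutionOfSingularities.ResolutionOfSingularities.Theorems.WildCones.MuDropCharTwoOrdP

namespace Summit.ResolutionOfSingularities.ResolutionOfSingularities.Theorems.WildQuotientResolution.S1.PlanarField

variable {κ : Type} [Field κ]

/-! ## Part V — the first step at a type-N node (`linearPart ≠ 0` nilpotent), chart 1 at 0
[OURS · L1 W4.5c]

Write `L = linearPart θ = [[a₁₀, a₀₁], [b₁₀, b₀₁]]`.  If `a₀₁ ≠ 0` the chart-1-at-0 set-up has `ma = 1`,
`mg = 2`, hence `s = β = 0`, `α = 1`, `θ' = (x·A, G)` with `A(0,0) = a₁₀`, `G(0,0) = b₁₀`,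
`G_y(0,0) = b₀₁ − a₁₀`, `G_x(0,0) = b₂₀`.  So: if `a₁₀ ≠ 0` the successor is not bad (brick B5's matrix
lemma); if `θ` is SHEARED (`a₁₀ = b₁₀ = b₀₁ = 0 ≠ a₀₁`) then `fA = 1`, `eG = 2`,
`μ(θ') = 1 + mb + I(A,B*) ∈ [3, μ + 1]` and `linearPart θ' = [[0,0],[b₂₀,0]]` (bad).  If `a₀₁ = a₁₀ = 0 ≠ b₁₀`
("lower" orientation) then `mg = 2` with `G(0,0) = b₁₀ ≠ 0`: the chart-1-at-0 successor is non-singular. -/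

/-! ### Coefficient bookkeeping -/

/-- `[x_i · x^d] (x_i · f) = [x^d] f`. [folklore] -/
theorem coeff_add_single_X_mul (i : Fin 2) (d : Fin 2 →₀ ℕ) (f : MvPowerSeries (Fin 2) κ) :
    coeff (Finsupp.single i 1 + d) (X i * f) = coeff d f := by
  rw [X_def, coeff_add_monomial_mul, one_mul]

/-- A monomial not divisible by `x_i` has coefficient `0` in `x_i · f`. [folklore] -/
theorem coeff_X_mul_of_apply_eq_zero (i : Fin 2) {d : Fin 2 →₀ ℕ} (hd : d i = 0)
    (f : MvPowerSeries (Fin 2) κ) : coeff d (X i * f) = 0 := by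
  classical
  rw [X_def, coeff_monomial_mul, if_neg]
  intro hle
  have h1 : 1 ≤ d i := Finsupp.single_le_iff.mp hle
  omega

/-- `[x_i^n · x^d] (x_i^n · f) = [x^d] f`. [folklore] -/
theorem coeff_add_X_pow_mul (i : Fin 2) (n : ℕ) (d : Fin 2 →₀ ℕ) (f : MvPowerSeries (Fin 2) κ) :
    coeff (Finsupp.single i n + d) (X i ^ n * f) = coeff d f := by
  rw [X_pow_eq, coeff_add_monomial_mul, one_mul]

/-- Coefficients along `B = (x, x y)`: `coeff (i + j, j) (g∘B) = coeff (i, j) g`. [folklore] -/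
theorem coeff_subst_blow' (g : MvPowerSeries (Fin 2) κ) (i j : ℕ) :
    coeff (Finsupp.single 0 (i + j) + Finsupp.single 1 j)
      (subst (![X 0, X 0 * X 1] : Fin 2 → MvPowerSeries (Fin 2) κ) g) =
      coeff (Finsupp.single 0 i + Finsupp.single 1 j) g := by
  have h := PlaneGerm.coeff_subst_blow g (Finsupp.single 0 i + Finsupp.single 1 j)
  have e0 : (Finsupp.single 0 i + Finsupp.single 1 j : Fin 2 →₀ ℕ) 0 = i := by simp
  have e1 : (Finsupp.single 0 i + Finsupp.single 1 j : Fin 2 →₀ ℕ) 1 = j := by simp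
  rw [e0, e1] at h
  exact h

/-- The low-order coefficients of `g = x·b − y·a` at a singular node: `g₂₀ = b₁₀`, `g₁₁ = b₀₁ − a₁₀`,
`g₀₂ = −a₀₁`, `g₃₀ = b₂₀`. [folklore] -/
theorem coeff_g_two_zero (θ : PlanarField κ) :
    coeff (Finsupp.single 0 2) (X 0 * θ.b - X 1 * θ.a) = coeff (Finsupp.single 0 1) θ.b := by
  rw [map_sub, show (Finsupp.single (0 : Fin 2) 2 : Fin 2 →₀ ℕ) = Finsupp.single 0 1 + Finsupp.single 0 1 from
    by rw [← Finsupp.single_add], coeff_add_single_X_mul,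
    coeff_X_mul_of_apply_eq_zero 1 (by simp) θ.a, sub_zero]

/-- `g₁₁ = b₀₁ − a₁₀` for `g = x·b − y·a`. [folklore] -/
theorem coeff_g_one_one (θ : PlanarField κ) :
    coeff (Finsupp.single 0 1 + Finsupp.single 1 1) (X 0 * θ.b - X 1 * θ.a) =
      coeff (Finsupp.single 1 1) θ.b - coeff (Finsupp.single 0 1) θ.a := by
  rw [map_sub, coeff_add_single_X_mul, add_comm, coeff_add_single_X_mul]

/-- `g₀₂ = −a₀₁` for `g = x·b − y·a`. [folklore] -/
theorem coeff_g_zero_two (θ : PlanarField κ) :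
    coeff (Finsupp.single 1 2) (X 0 * θ.b - X 1 * θ.a) = - coeff (Finsupp.single 1 1) θ.a := by
  rw [map_sub, coeff_X_mul_of_apply_eq_zero 0 (by simp) θ.b,
    show (Finsupp.single (1 : Fin 2) 2 : Fin 2 →₀ ℕ) = Finsupp.single 1 1 + Finsupp.single 1 1 from
    by rw [← Finsupp.single_add], coeff_add_single_X_mul, zero_sub]

/-- `g₃₀ = b₂₀` for `g = x·b − y·a`. [folklore] -/
theorem coeff_g_three_zero (θ : PlanarField κ) :
    coeff (Finsupp.single 0 3) (X 0 * θ.b - X 1 * θ.a) = coeff (Finsupp.single 0 2) θ.b := by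
  rw [map_sub, show (Finsupp.single (0 : Fin 2) 3 : Fin 2 →₀ ℕ) = Finsupp.single 0 1 + Finsupp.single 0 2 from
    by rw [← Finsupp.single_add], coeff_add_single_X_mul,
    coeff_X_mul_of_apply_eq_zero 1 (by simp) θ.a, sub_zero]

/-- The `y`-axis restriction has order `≥ n` as soon as the coefficients of `y^k`, `k < n`, vanish. [folklore] -/
theorem le_order_killCompl {G : MvPowerSeries (Fin 2) κ} {n : ℕ}
    (h : ∀ k < n, coeff (Finsupp.single 1 k) G = 0) :
    (n : ℕ∞) ≤ (killCompl (⟨fun _ => (1 : Fin 2), fun a b _ => Subsingleton.elim a b⟩ : Fin 1 ↪ Fin 2) G).order := by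
  refine nat_le_order fun d hd => ?_
  have hd' : d = Finsupp.single 0 (d 0) := Finsupp.ext fun i => by fin_cases i; simp
  rw [hd', Finsupp.degree_single] at hd
  rw [hd', coeff_killCompl_axis]
  exact h (d 0) (by exact_mod_cast hd)

/-! ### The set-up at a node with `a₀₁ ≠ 0` -/

/-- TYPE-N SET-UP (chart 1 at 0) at a singular node with `a₀₁ ≠ 0`: `ma = 1`, `mg = 2`, so the isolated
successor is `θ' = (x·A, G)` with `a∘B = x·A`, `g∘B = x²·G`, `x·G = x^mb·B* − y·x·A`, and the jets
`A(0,0) = a₁₀`, `G(0,0) = b₁₀`, `G_y(0,0) = b₀₁ − a₁₀`, `G_x(0,0) = b₂₀`; moreover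
`μ(θ') = eG + I(A,G)`, `fA + I(A,G) = mb·fA + I(A,B*)`, `I(A,B*) + mb ≤ μ(θ)`, `fA ≤ 1`, `eG ≤ 2`.
[OURS · L1 W4.5c] -/
theorem exists_typeN_setup (θ θ' : PlanarField κ) (hiso : θ.IsIsolated) (hsing : θ.IsSingular)
    (h01 : θ.linearPart 0 1 ≠ 0) (hsucc : IsSuccChart1 0 θ θ') (hiso' : θ'.IsIsolated) :
    ∃ (A Bst G : MvPowerSeries (Fin 2) κ) (mb : ℕ),
      (mb : ℕ∞) = θ.b.order ∧ 1 ≤ mb ∧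
      subst (![X 0, X 0 * X 1] : Fin 2 → MvPowerSeries (Fin 2) κ) θ.a = X 0 ^ 1 * A ∧
      killCompl (⟨fun _ => (1 : Fin 2), fun a b _ => Subsingleton.elim a b⟩ : Fin 1 ↪ Fin 2) A ≠ 0 ∧
      subst (![X 0, X 0 * X 1] : Fin 2 → MvPowerSeries (Fin 2) κ) θ.b = X 0 ^ mb * Bst ∧
      killCompl (⟨fun _ => (1 : Fin 2), fun a b _ => Subsingleton.elim a b⟩ : Fin 1 ↪ Fin 2) Bst ≠ 0 ∧
      (killCompl (⟨fun _ => (1 : Fin 2), fun a b _ => Subsingleton.elim a b⟩ : Fin 1 ↪ Fin 2) Bst).order ≤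
        (mb : ℕ∞) ∧
      subst (![X 0, X 0 * X 1] : Fin 2 → MvPowerSeries (Fin 2) κ) (X 0 * θ.b - X 1 * θ.a) = X 0 ^ 2 * G ∧
      killCompl (⟨fun _ => (1 : Fin 2), fun a b _ => Subsingleton.elim a b⟩ : Fin 1 ↪ Fin 2) G ≠ 0 ∧
      θ'.a = X 0 * A ∧ θ'.b = G ∧
      X 0 ^ 1 * G = X 0 ^ mb * Bst - X 1 * X 0 ^ 1 * A ∧
      constantCoeff A = θ.linearPart 0 0 ∧ constantCoeff G = θ.linearPart 1 0 ∧
      coeff (Finsupp.single 1 1) G = θ.linearPart 1 1 - θ.linearPart 0 0 ∧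
      coeff (Finsupp.single 0 1) G = coeff (Finsupp.single 0 2) θ.b ∧
      Module.Finite κ (MvPowerSeries (Fin 2) κ ⧸ Ideal.span {A, G}) ∧
      Module.Finite κ (MvPowerSeries (Fin 2) κ ⧸ Ideal.span {A, Bst}) ∧
      θ'.milnor = Module.finrank κ (MvPowerSeries (Fin 2) κ ⧸ Ideal.span {G, (X 0 : MvPowerSeries (Fin 2) κ)}) +
        Module.finrank κ (MvPowerSeries (Fin 2) κ ⧸ Ideal.span {A, G}) ∧
      Module.finrank κ (MvPowerSeries (Fin 2) κ ⧸ Ideal.span {A, (X 0 : MvPowerSeries (Fin 2) κ)}) +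
          Module.finrank κ (MvPowerSeries (Fin 2) κ ⧸ Ideal.span {A, G}) =
        mb * Module.finrank κ (MvPowerSeries (Fin 2) κ ⧸ Ideal.span {A, (X 0 : MvPowerSeries (Fin 2) κ)}) +
          Module.finrank κ (MvPowerSeries (Fin 2) κ ⧸ Ideal.span {A, Bst}) ∧
      Module.finrank κ (MvPowerSeries (Fin 2) κ ⧸ Ideal.span {A, Bst}) + mb ≤ θ.milnor ∧
      Module.finrank κ (MvPowerSeries (Fin 2) κ ⧸ Ideal.span {A, (X 0 : MvPowerSeries (Fin 2) κ)}) ≤ 1 ∧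
      Module.finrank κ (MvPowerSeries (Fin 2) κ ⧸ Ideal.span {G, (X 0 : MvPowerSeries (Fin 2) κ)}) ≤ 2 := by
  have ha01 : coeff (Finsupp.single 1 1) θ.a ≠ 0 := by rwa [linearPart_apply_zero] at h01
  have ha0 : θ.a ≠ 0 := fun h => ha01 (by rw [h, map_zero])
  have hb0 : θ.b ≠ 0 := (ne_zero_of_isIsolated θ hiso hsing).2
  -- `ord a = 1`
  have ha_le : θ.a.order ≤ 1 := by
    have := order_le ha01; rwa [Finsupp.degree_single, Nat.cast_one] at this
  have ha_ge : 1 ≤ θ.a.order := one_le_order_iff_constCoeff_eq_zero.mpr hsing.1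
  have ha_ord : θ.a.order = 1 := le_antisymm ha_le ha_ge
  have hb_ge : 1 ≤ θ.b.order := one_le_order_iff_constCoeff_eq_zero.mpr hsing.2
  -- `g ≠ 0` of order `≤ 2` (coefficient of `y²` is `−a₀₁`)
  have hg02 : coeff (Finsupp.single 1 2) (X 0 * θ.b - X 1 * θ.a) ≠ 0 := by
    rw [coeff_g_zero_two]; exact neg_ne_zero.mpr ha01
  have hg0 : X 0 * θ.b - X 1 * θ.a ≠ 0 := fun h => hg02 (by rw [h, map_zero])
  have hg_le : (X 0 * θ.b - X 1 * θ.a).order ≤ 2 := by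
    have := order_le hg02; rwa [Finsupp.degree_single, Nat.cast_ofNat] at this
  obtain ⟨A, Bst, G, ma, mb, mg, s, α, β, hma, hmb, hmg, hmgb, hA, hKA, hνA, hB, hKB, hνB, hG, hKG, hνG,
    hsα, hsβ, hsat, ha', hb', hid, hfinAG, hμ'⟩ := exists_chart1_zero_setup θ θ' ha0 hb0 hg0 hsucc hiso'
  have hma1 : ma = 1 := by
    have h : (ma : ℕ∞) = 1 := hma.trans ha_ord
    exact_mod_cast h
  have hmb1 : 1 ≤ mb := by rw [← hmb] at hb_ge; exact_mod_cast hb_ge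
  have hmg2 : mg = 2 := by
    have h1 : 2 ≤ mg := by rw [hma1, min_eq_left hmb1] at hmgb; exact hmgb
    have h2 : mg ≤ 2 := by rw [← hmg] at hg_le; exact_mod_cast hg_le
    omega
  have hs0 : s = 0 := by omega
  have hβ0 : β = 0 := by omega
  have hα1 : α = 1 := by omega
  rw [hma1] at hA hνA hid
  rw [hmg2] at hG hνG
  rw [hα1, pow_one] at ha'
  rw [hβ0, pow_zero, one_mul] at hb'
  rw [hs0, hβ0] at hid
  rw [hα1, hβ0, one_mul, zero_mul, add_zero] at hμ'
  -- jets of `A` and `G`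
  have hA00 : constantCoeff A = θ.linearPart 0 0 := by
    rw [linearPart_apply_zero]
    have h1 := coeff_subst_blow' θ.a 1 0
    simp only [add_zero, Finsupp.single_zero] at h1
    rw [hA, pow_one] at h1
    have h2 := coeff_add_single_X_mul 0 0 A
    rw [add_zero, coeff_zero_eq_constantCoeff_apply] at h2
    rw [← h1, h2]
  have hGx2 : ∀ d : Fin 2 →₀ ℕ, coeff (Finsupp.single 0 2 + d)
      (subst (![X 0, X 0 * X 1] : Fin 2 → MvPowerSeries (Fin 2) κ) (X 0 * θ.b - X 1 * θ.a)) = coeff d G := by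
    intro d; rw [hG, coeff_add_X_pow_mul]
  have hG00 : constantCoeff G = θ.linearPart 1 0 := by
    rw [linearPart_apply_one, ← coeff_g_two_zero, ← coeff_zero_eq_constantCoeff_apply, ← hGx2 0]
    have h1 := coeff_subst_blow' (X 0 * θ.b - X 1 * θ.a) 2 0
    simp only [add_zero, Finsupp.single_zero] at h1
    rw [add_zero, h1]
  have hG01 : coeff (Finsupp.single 1 1) G = θ.linearPart 1 1 - θ.linearPart 0 0 := by
    rw [linearPart_apply_one, linearPart_apply_zero, ← coeff_g_one_one, ← hGx2 (Finsupp.single 1 1)]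
    have h1 := coeff_subst_blow' (X 0 * θ.b - X 1 * θ.a) 1 1
    exact h1
  have hG10 : coeff (Finsupp.single 0 1) G = coeff (Finsupp.single 0 2) θ.b := by
    rw [← coeff_g_three_zero, ← hGx2 (Finsupp.single 0 1)]
    have h1 := coeff_subst_blow' (X 0 * θ.b - X 1 * θ.a) 3 0
    simp only [add_zero, Finsupp.single_zero] at h1
    rw [← Finsupp.single_add, h1]
  -- the colength identity and Noether
  obtain ⟨hfinAB, hF2⟩ := colength_identity hKA hid hfinAG
  rw [zero_add, add_zero, one_mul] at hF2
  have hF1 : Module.finrank κ (MvPowerSeries (Fin 2) κ ⧸ Ideal.span {A, Bst}) + 1 * mb ≤ θ.milnor :=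
    noether_inequality (mf := 1) (mg := mb) (by rw [ha_ord, Nat.cast_one]) hmb.le hA hB hKA
      (hνA.trans (by exact_mod_cast Nat.le_add_right 1 mb)) hiso hfinAB
  rw [one_mul] at hF1
  -- `fA ≤ 1`, `eG ≤ 2`
  obtain ⟨-, hfA⟩ := colength_X_eq_order hKA
  obtain ⟨-, heG⟩ := colength_X_eq_order hKG
  have hF3 : Module.finrank κ (MvPowerSeries (Fin 2) κ ⧸ Ideal.span {A, (X 0 : MvPowerSeries (Fin 2) κ)}) ≤ 1 := by
    rw [Ideal.span_pair_comm, hfA]; exact ENat.toNat_le_of_le_coe hνA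
  have hF4 : Module.finrank κ (MvPowerSeries (Fin 2) κ ⧸ Ideal.span {G, (X 0 : MvPowerSeries (Fin 2) κ)}) ≤ 2 := by
    rw [Ideal.span_pair_comm, heG]; exact ENat.toNat_le_of_le_coe hνG
  exact ⟨A, Bst, G, mb, hmb, hmb1, hA, hKA, hB, hKB, hνB, hG, hKG, ha', hb', hid, hA00, hG00, hG01, hG10,
    hfinAG, hfinAB, hμ', hF2, hF1, hF3, hF4⟩

end Summit.ResolutionOfSingularities.ResolutionOfSingularities.Theorems.WildQuotientResolution.S1.PlanarField

end
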